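import Mathlib.Analysis.Calculus.ContDiff.Deriv
import Mathlib.Analysis.Calculus.Deriv.Mul
import Mathlib.Analysis.Calculus.Deriv.Comp
import Mathlib.Analysis.Calculus.Deriv.Add
import Mathlib.Analysis.Calculus.Deriv.Shift
import Mathlib.Analysis.SpecialFunctions.Pow.Real
import Mathlib.Analysis.Complex.RealDeriv
import Literature.Geometry.Lorentzian.KerrSchild
import HarnessLib

/-!
# The explicit quadratic phase of a Gaussian beam in a time-foliated chart, and its first and
# second derivatives
(trunk G08 = T-LORENTZ, geometric optics; namespace `Literature.Geometry.Lorentzian.GaussianBeam`)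

In Sbierski's construction of Gaussian beams (Anal. PDE 8 (2015), §3 = arXiv:1311.2477v2 §2.2;
after Ralston 1982) the phase `φ ∈ C^∞(M, ℂ)` of `u_λ = a e^{iλφ}` is any function with prescribed
first and second derivatives along the null geodesic `γ`: `dφ|_γ = γ̇♭` real ((3.12)/(2.17)),
`∂∂φ|_γ = M` complex symmetric with `Im M` positive definite transversally ((3.3)/(2.10)), the jets
being compatible, `M γ̇ = (dφ)˙` ((2.21)); the source builds such a `φ` from the jets by Borel's
lemma in slice coordinates ("Writing down the formal Taylor series up to order two for `φ` […] we
construct […] `φ ∈ C^∞(U, ℂ)`", arXiv p. 14). In a chart `ℝ⁴ ∋ x = (t, x⃗)` foliated by the time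
coordinate and along a curve transversal to the leaves, `X(t) = (t, c(t))`, the Taylor polynomial
itself is a global choice: with real momenta `P(t) ∈ ℝ⁴` and a complex symmetric `M(t) ∈ ℂ^{4×4}`,

`φ(x) = ∑ᵢ P_{i+1}(t) dᵢ + ½ ∑_{ij} M_{i+1,j+1}(t) dᵢ dⱼ`, `d = x⃗ − c(t)`, `t = x⁰`,

is **exactly quadratic on every leaf** (so `Im φ = ½ Im M(d, d)` is an exact Gaussian exponent) and
has the prescribed jets along `X`: `∂_μφ(X(t)) = P_μ(t)` provided `P · Ẋ = 0` (`Ẋ = (1, ċ)`; for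
a null bicharacteristic `P(Ẋ) = g⁻¹(P, P)/κ = 0`), and `∂_μ∂_νφ(X(t)) = M_{μν}(t)` provided `M` is
symmetric and compatible, `M Ẋ = Ṗ` — the time rows of the Hessian being forced by the
compatibility exactly as in (2.21).

This file records that elementary calculus, with explicit component functions for the first and
second partial derivatives (so that later files — the eikonal defect, the wave operator applied
to the beam, the energy — manipulate closed expressions rather than iterated Fréchet derivatives):

* `GaussianBeam.phase`, `GaussianBeam.dphase`, `GaussianBeam.ddphase` — the phase and the explicit
  components of `∂_μφ`, `∂_μ∂_νφ` (derivatives of the data entering through `deriv`);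
* `hasDerivAt_phase_spaceLine`, `hasDerivAt_phase_timeLine`, `hasDerivAt_dphase_succ_spaceLine`,
  `hasDerivAt_dphase_zero_spaceLine`, `hasDerivAt_dphase_succ_timeLine`,
  `hasDerivAt_dphase_zero_timeLine` — the derivatives of `φ` and of `∂_νφ` along the coordinate
  lines `s ↦ x + s ∂_μ` are `dphase μ x`, `ddphase μ ν x`; `contDiffOn_phase`, `contDiffOn_dphase`,
  `fderiv_phase`, `fderiv_dphase` — `φ` and `∂φ` are `C^∞` on the slab over the (open) parameter set
  and their Fréchet partial derivatives are these components;
* `dphase_curve`, `ddphase_curve` — the jets along `X(t) = (t, c(t))`: `∂φ = P`, `∂∂φ = M` under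
  `P · Ẋ = 0`, `M` symmetric, `M Ẋ = Ṗ` (Sbierski's (3.12), (2.21)); `deriv_constraint_eq_zero` —
  the differentiated constraint;
* `im_phase`, `exists_pos_le_imQuad`, `exists_pos_le_im_phase` — `Im φ(x) = ½ ∑ Im M_{i+1,j+1}(t) dᵢ dⱼ`,
  and a uniform Gaussian lower bound `Im φ ≥ c₀ ‖d‖²` over compact parameter sets when `Im M(t)` is
  positive definite on spatial vectors (Sbierski's (3.4): "`Im(φ)(x) ≥ c · (x₁² + x₂² + x₃²)`").

The chart is `E4 = EuclideanSpace ℝ (Fin 4)` with `x 0` the time (the conventions of the Kerr–Schild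
files, `Literature.Geometry.Lorentzian.E4`); no metric enters this file.

## References

* J. Sbierski, *Characterisation of the energy of Gaussian beams on Lorentzian manifolds: with
  applications to black hole spacetimes*, Anal. PDE 8 (2015) 1379–1420, §3, (3.2)–(3.4), (3.12);
  arXiv:1311.2477v2 §2.2, (2.10)–(2.11), (2.17), (2.21), p. 14 (key `Sbierski2015`).
* J. Ralston, *Gaussian beams and the propagation of singularities*, MAA Stud. Math. 23 (1982)
  206–248, §2 (key `Ralston1982`).
-/

noncomputable section

open Set Filter
open scoped ContDiff Topology

namespace Literature.Geometry.Lorentzian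

namespace GaussianBeam

/-! ### Derivatives of the data -/

/-- `ċᵢ(t)`, the velocity of the spatial centre. [folklore] -/
def cdot (c : ℝ → E3) (t : ℝ) (i : Fin 3) : ℝ := deriv (fun s ↦ c s i) t

/-- `c̈ᵢ(t)`. [folklore] -/
def cddot (c : ℝ → E3) (t : ℝ) (i : Fin 3) : ℝ := deriv (fun s ↦ cdot c s i) t

/-- `Ṗ_μ(t)`. [folklore] -/
def pdot (P : ℝ → Fin 4 → ℝ) (t : ℝ) (μ : Fin 4) : ℝ := deriv (fun s ↦ P s μ) t

/-- `P̈_μ(t)`. [folklore] -/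
def pddot (P : ℝ → Fin 4 → ℝ) (t : ℝ) (μ : Fin 4) : ℝ := deriv (fun s ↦ pdot P s μ) t

/-- `Ṁ_{μν}(t)`. [folklore] -/
def mdot (M : ℝ → Fin 4 → Fin 4 → ℂ) (t : ℝ) (μ ν : Fin 4) : ℂ := deriv (fun s ↦ M s μ ν) t

/-- `M̈_{μν}(t)`. [folklore] -/
def mddot (M : ℝ → Fin 4 → Fin 4 → ℂ) (t : ℝ) (μ ν : Fin 4) : ℂ := deriv (fun s ↦ mdot M s μ ν) t

/-! ### The phase and its explicit derivatives -/

/-- The spatial displacement from the centre, `dᵢ(x) = x_{i+1} − cᵢ(x⁰)`. [folklore] -/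
def disp (c : ℝ → E3) (x : E4) (i : Fin 3) : ℝ := x i.succ - c (x 0) i

/-- **The explicit quadratic Gaussian-beam phase** in a time-foliated chart along the curve
`X(t) = (t, c(t))`, with real momenta `P(t)` and complex second derivatives `M(t)`:
`φ(x) = ∑ᵢ P_{i+1}(x⁰) dᵢ(x) + ½ ∑_{ij} M_{i+1,j+1}(x⁰) dᵢ(x) dⱼ(x)` — the second-order Taylor
polynomial in the leaf through `x` of any phase with the jets of Sbierski's construction
(Anal. PDE 8 (2015), §3, (3.12) and arXiv:1311.2477v2 §2.2, p. 14: "the formal Taylor series up to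
order two for `φ` […] in the slice coordinates"). [cite: Sbierski2015, §3 (3.12); arXiv v2 §2.2 p. 14] -/
def phase (P : ℝ → Fin 4 → ℝ) (M : ℝ → Fin 4 → Fin 4 → ℂ) (c : ℝ → E3) (x : E4) : ℂ :=
  ∑ i : Fin 3, (P (x 0) i.succ : ℂ) * (disp c x i : ℂ) +
    2⁻¹ * ∑ i : Fin 3, ∑ j : Fin 3, M (x 0) i.succ j.succ * (disp c x i : ℂ) * (disp c x j : ℂ)

/-- **The components `∂_μφ` of the differential of the phase** (explicit): for spatial `μ = k+1`,
`∂_{k+1}φ = P_{k+1} + ½ ∑ⱼ (M_{k+1,j+1} + M_{j+1,k+1}) dⱼ`; for `μ = 0`,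
`∂₀φ = ∑ᵢ (Ṗ_{i+1} dᵢ − P_{i+1} ċᵢ) + ½ ∑_{ij} (Ṁ_{i+1,j+1} dᵢ dⱼ − M_{i+1,j+1} (ċᵢ dⱼ + dᵢ ċⱼ))`.
[cite: Sbierski2015, §3 (3.12); arXiv v2 §2.2 (2.17)] -/
def dphase (P : ℝ → Fin 4 → ℝ) (M : ℝ → Fin 4 → Fin 4 → ℂ) (c : ℝ → E3) (μ : Fin 4) (x : E4) : ℂ :=
  Fin.cases
    (∑ i : Fin 3, ((pdot P (x 0) i.succ : ℂ) * (disp c x i : ℂ) -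
        (P (x 0) i.succ : ℂ) * (cdot c (x 0) i : ℂ)) +
      2⁻¹ * ∑ i : Fin 3, ∑ j : Fin 3, (mdot M (x 0) i.succ j.succ * (disp c x i : ℂ) * (disp c x j : ℂ) -
        M (x 0) i.succ j.succ * ((cdot c (x 0) i : ℂ) * (disp c x j : ℂ) +
          (disp c x i : ℂ) * (cdot c (x 0) j : ℂ))))
    (fun k ↦ (P (x 0) k.succ : ℂ) +
      2⁻¹ * ∑ j : Fin 3, (M (x 0) k.succ j.succ + M (x 0) j.succ k.succ) * (disp c x j : ℂ))
    μ

/-- **The components `∂_μ∂_νφ` of the Hessian of the phase** (explicit; symmetric in `μ, ν`):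
spatial–spatial `½ (M_{k+1,l+1} + M_{l+1,k+1})`; time–spatial
`Ṗ_{l+1} + ½ ∑ⱼ (Ṁ_{l+1,j+1} + Ṁ_{j+1,l+1}) dⱼ − ½ ∑ⱼ (M_{l+1,j+1} + M_{j+1,l+1}) ċⱼ`; time–time
`∑ᵢ (P̈_{i+1} dᵢ − 2 Ṗ_{i+1} ċᵢ − P_{i+1} c̈ᵢ) + ½ ∑_{ij} (M̈_{i+1,j+1} dᵢ dⱼ − 2 Ṁ_{i+1,j+1} (ċᵢ dⱼ + dᵢ ċⱼ)
 − M_{i+1,j+1} (c̈ᵢ dⱼ + dᵢ c̈ⱼ) + 2 M_{i+1,j+1} ċᵢ ċⱼ)`. [cite: Sbierski2015, §3 (3.9); arXiv v2 §2.2 (2.21)] -/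
def ddphase (P : ℝ → Fin 4 → ℝ) (M : ℝ → Fin 4 → Fin 4 → ℂ) (c : ℝ → E3) (μ ν : Fin 4) (x : E4) :
    ℂ :=
  Fin.cases
    (Fin.cases
      (∑ i : Fin 3, ((pddot P (x 0) i.succ : ℂ) * (disp c x i : ℂ) -
          2 * (pdot P (x 0) i.succ : ℂ) * (cdot c (x 0) i : ℂ) -
          (P (x 0) i.succ : ℂ) * (cddot c (x 0) i : ℂ)) +
        2⁻¹ * ∑ i : Fin 3, ∑ j : Fin 3,
          (mddot M (x 0) i.succ j.succ * (disp c x i : ℂ) * (disp c x j : ℂ) -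
            2 * mdot M (x 0) i.succ j.succ * ((cdot c (x 0) i : ℂ) * (disp c x j : ℂ) +
              (disp c x i : ℂ) * (cdot c (x 0) j : ℂ)) -
            M (x 0) i.succ j.succ * ((cddot c (x 0) i : ℂ) * (disp c x j : ℂ) +
              (disp c x i : ℂ) * (cddot c (x 0) j : ℂ)) +
            2 * M (x 0) i.succ j.succ * (cdot c (x 0) i : ℂ) * (cdot c (x 0) j : ℂ)))
      (fun l ↦ (pdot P (x 0) l.succ : ℂ) +
        2⁻¹ * ∑ j : Fin 3, (mdot M (x 0) l.succ j.succ + mdot M (x 0) j.succ l.succ) * (disp c x j : ℂ) -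
        2⁻¹ * ∑ j : Fin 3, (M (x 0) l.succ j.succ + M (x 0) j.succ l.succ) * (cdot c (x 0) j : ℂ))
      ν)
    (fun k ↦ Fin.cases
      ((pdot P (x 0) k.succ : ℂ) +
        2⁻¹ * ∑ j : Fin 3, (mdot M (x 0) k.succ j.succ + mdot M (x 0) j.succ k.succ) * (disp c x j : ℂ) -
        2⁻¹ * ∑ j : Fin 3, (M (x 0) k.succ j.succ + M (x 0) j.succ k.succ) * (cdot c (x 0) j : ℂ))
      (fun l ↦ 2⁻¹ * (M (x 0) k.succ l.succ + M (x 0) l.succ k.succ))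
      ν)
    μ

/-! ### Coordinate lines -/

/-- Components of a point moved along a coordinate line: `(x + s ∂_μ)_ν = x_ν + s δ_{μν}`. [folklore] -/
theorem apply_add_smul_basisVector (x : E4) (s : ℝ) (μ ν : Fin 4) :
    (x + s • E4.basisVector μ) ν = x ν + if ν = μ then s else 0 := by
  simp

/-- The time coordinate is constant along spatial coordinate lines. [folklore] -/
theorem apply_zero_add_smul_basisVector_succ (x : E4) (s : ℝ) (k : Fin 3) :
    (x + s • E4.basisVector k.succ) 0 = x 0 := by
  rw [apply_add_smul_basisVector, if_neg (Fin.succ_ne_zero k).symm, add_zero]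

/-- The time coordinate along the time line. [folklore] -/
theorem apply_zero_add_smul_basisVector_zero (x : E4) (s : ℝ) :
    (x + s • E4.basisVector 0) 0 = x 0 + s := by
  rw [apply_add_smul_basisVector]
  simp

/-- The displacement along a spatial coordinate line: `dᵢ(x + s ∂_{k+1}) = dᵢ(x) + s δ_{ik}`. [folklore] -/
theorem disp_add_smul_basisVector_succ (c : ℝ → E3) (x : E4) (s : ℝ) (k i : Fin 3) :
    disp c (x + s • E4.basisVector k.succ) i = disp c x i + if i = k then s else 0 := by
  unfold disp
  rw [apply_add_smul_basisVector, apply_zero_add_smul_basisVector_succ]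
  simp only [Fin.succ_inj]
  ring

/-- The displacement along the time line: `dᵢ(x + s ∂₀) = x_{i+1} − cᵢ(x⁰ + s)`. [folklore] -/
theorem disp_add_smul_basisVector_zero (c : ℝ → E3) (x : E4) (s : ℝ) (i : Fin 3) :
    disp c (x + s • E4.basisVector 0) i = x i.succ - c (x 0 + s) i := by
  unfold disp
  rw [apply_add_smul_basisVector, apply_zero_add_smul_basisVector_zero]
  simp [Fin.succ_ne_zero]

/-! ### One-variable derivatives of affine and quadratic sums -/

/-- `d/ds|₀ ∑ᵢ uᵢ (dᵢ + δ_{ik} s) = u_k`. [folklore] -/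
theorem hasDerivAt_sum_mul_affine (u d : Fin 3 → ℂ) (k : Fin 3) :
    HasDerivAt (fun s : ℝ ↦ ∑ i, u i * (d i + ((if i = k then s else 0 : ℝ) : ℂ))) (u k) 0 := by
  have h : ∀ i, HasDerivAt (fun s : ℝ ↦ u i * (d i + ((if i = k then s else 0 : ℝ) : ℂ)))
      (if i = k then u i else 0) 0 := by
    intro i
    by_cases hik : i = k
    · subst hik
      simp only [if_true]
      have h1 : HasDerivAt (fun s : ℝ ↦ ((s : ℝ) : ℂ)) 1 0 := by
        simpa using HasDerivAt.ofReal_comp (hasDerivAt_id (0 : ℝ))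
      simpa using (h1.const_add (d i)).const_mul (u i)
    · simp only [hik, if_false, Complex.ofReal_zero, add_zero]
      exact hasDerivAt_const _ _
  have hs := HasDerivAt.fun_sum (u := Finset.univ) fun i _ ↦ h i
  simpa [Finset.sum_ite_eq'] using hs

/-- `d/ds|₀ ∑_{ij} m_{ij} (dᵢ + δ_{ik} s)(dⱼ + δ_{jk} s) = ∑ⱼ m_{kj} dⱼ + ∑ᵢ m_{ik} dᵢ`. [folklore] -/
theorem hasDerivAt_sum_sum_mul_affine (m : Fin 3 → Fin 3 → ℂ) (d : Fin 3 → ℂ) (k : Fin 3) :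
    HasDerivAt (fun s : ℝ ↦ ∑ i, ∑ j, m i j * (d i + ((if i = k then s else 0 : ℝ) : ℂ)) *
        (d j + ((if j = k then s else 0 : ℝ) : ℂ)))
      (∑ j, m k j * d j + ∑ i, m i k * d i) 0 := by
  -- the affine factors
  have ha : ∀ i, HasDerivAt (fun s : ℝ ↦ d i + ((if i = k then s else 0 : ℝ) : ℂ))
      (if i = k then 1 else 0) 0 := by
    intro i
    by_cases hik : i = k
    · subst hik
      simp only [if_true]
      have h1 : HasDerivAt (fun s : ℝ ↦ ((s : ℝ) : ℂ)) 1 0 := by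
        simpa using HasDerivAt.ofReal_comp (hasDerivAt_id (0 : ℝ))
      exact h1.const_add (d i)
    · simp only [hik, if_false, Complex.ofReal_zero, add_zero]
      exact hasDerivAt_const _ _
  have ha0 : ∀ i, (d i + ((if i = k then (0 : ℝ) else 0 : ℝ) : ℂ)) = d i := fun i ↦ by simp
  have h : ∀ i j, HasDerivAt (fun s : ℝ ↦ m i j * (d i + ((if i = k then s else 0 : ℝ) : ℂ)) *
      (d j + ((if j = k then s else 0 : ℝ) : ℂ)))
      (m i j * (if i = k then 1 else 0) * d j + m i j * d i * (if j = k then 1 else 0)) 0 := by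
    intro i j
    have := ((ha i).const_mul (m i j)).mul (ha j)
    simp only [ha0] at this
    exact this
  have hs := HasDerivAt.fun_sum (u := Finset.univ) fun i _ ↦
    HasDerivAt.fun_sum (u := Finset.univ) fun j _ ↦ h i j
  refine hs.congr_deriv ?_
  simp only [Finset.sum_add_distrib, mul_ite, mul_one, mul_zero, ite_mul, zero_mul,
    Finset.sum_ite_eq', Finset.mem_univ, if_true]
  have e1 : (∑ x, ∑ y, if x = k then m x y * d y else 0) = ∑ y, m k y * d y := by
    rw [Finset.sum_eq_single k (fun x _ hx ↦ by simp [hx]) (by simp)]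
    simp
  rw [e1, add_comm]

/-! ### The phase along spatial coordinate lines -/

/-- **`∂_{k+1}φ` along the spatial coordinate line**: `d/ds|₀ φ(x + s ∂_{k+1}) = dphase (k+1) x`
(the phase is an explicit polynomial on each leaf). [cite: Sbierski2015, §3 (3.12)] -/
theorem hasDerivAt_phase_spaceLine (P : ℝ → Fin 4 → ℝ) (M : ℝ → Fin 4 → Fin 4 → ℂ) (c : ℝ → E3)
    (x : E4) (k : Fin 3) :
    HasDerivAt (fun s : ℝ ↦ phase P M c (x + s • E4.basisVector k.succ)) (dphase P M c k.succ x) 0 := by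
  have h1 := hasDerivAt_sum_mul_affine (fun i ↦ (P (x 0) i.succ : ℂ)) (fun i ↦ (disp c x i : ℂ)) k
  have h2 := hasDerivAt_sum_sum_mul_affine (fun i j ↦ M (x 0) i.succ j.succ)
    (fun i ↦ (disp c x i : ℂ)) k
  have h := h1.add (h2.const_mul (2⁻¹ : ℂ))
  have hfun : (fun s : ℝ ↦ phase P M c (x + s • E4.basisVector k.succ)) = fun s : ℝ ↦
      ∑ i, (P (x 0) i.succ : ℂ) * ((disp c x i : ℂ) + ((if i = k then s else 0 : ℝ) : ℂ)) +
      2⁻¹ * ∑ i, ∑ j, M (x 0) i.succ j.succ * ((disp c x i : ℂ) + ((if i = k then s else 0 : ℝ) : ℂ)) *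
        ((disp c x j : ℂ) + ((if j = k then s else 0 : ℝ) : ℂ)) := by
    funext s
    simp only [phase, apply_zero_add_smul_basisVector_succ, disp_add_smul_basisVector_succ,
      Complex.ofReal_add]
  refine (h.congr_deriv ?_).congr_of_eventuallyEq (Eventually.of_forall fun s ↦ congrFun hfun s)
  simp only [dphase, Fin.cases_succ, add_mul, Finset.sum_add_distrib, Finset.mul_sum]


/-! ### The phase along the time line -/

/-- Shift of the base point: `d/ds|₀ f(a + s) = f'(a)`. [folklore] -/
theorem hasDerivAt_shift {F : Type*} [NormedAddCommGroup F] [NormedSpace ℝ F] {f : ℝ → F} {f' : F}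
    {a : ℝ} (h : HasDerivAt f f' a) : HasDerivAt (fun s ↦ f (a + s)) f' 0 := by
  have h' : HasDerivAt f f' (a + 0) := by rwa [add_zero]
  exact HasDerivAt.comp_const_add a 0 h'

/-- **`∂₀φ` along the time line**: `d/ds|₀ φ(x + s ∂₀) = dphase 0 x`, for data differentiable at
`x⁰` (product and chain rules; the centre, the momenta and the matrix all move with `t`).
[cite: Sbierski2015, §3 (3.12); arXiv v2 §2.2 (2.17)] -/
theorem hasDerivAt_phase_timeLine (P : ℝ → Fin 4 → ℝ) (M : ℝ → Fin 4 → Fin 4 → ℂ) (c : ℝ → E3)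
    (x : E4) (hP : ∀ μ, DifferentiableAt ℝ (fun t ↦ P t μ) (x 0))
    (hM : ∀ μ ν, DifferentiableAt ℝ (fun t ↦ M t μ ν) (x 0))
    (hc : ∀ i, DifferentiableAt ℝ (fun t ↦ c t i) (x 0)) :
    HasDerivAt (fun s : ℝ ↦ phase P M c (x + s • E4.basisVector 0)) (dphase P M c 0 x) 0 := by
  -- the moving data along the line
  have hp : ∀ i : Fin 3, HasDerivAt (fun s : ℝ ↦ (P (x 0 + s) i.succ : ℂ))
      (pdot P (x 0) i.succ : ℂ) 0 := fun i ↦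
    HasDerivAt.ofReal_comp (hasDerivAt_shift (hP i.succ).hasDerivAt)
  have hm : ∀ i j : Fin 3, HasDerivAt (fun s : ℝ ↦ M (x 0 + s) i.succ j.succ)
      (mdot M (x 0) i.succ j.succ) 0 := fun i j ↦
    hasDerivAt_shift (hM i.succ j.succ).hasDerivAt
  have hδ : ∀ i : Fin 3, HasDerivAt (fun s : ℝ ↦ ((x i.succ - c (x 0 + s) i : ℝ) : ℂ))
      (((-cdot c (x 0) i : ℝ)) : ℂ) 0 := fun i ↦ by
    have h := (hasDerivAt_shift (hc i).hasDerivAt).const_sub (x i.succ)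
    exact HasDerivAt.ofReal_comp h
  -- the two sums
  have h1 := HasDerivAt.fun_sum (u := Finset.univ) fun i (_ : i ∈ Finset.univ) ↦ (hp i).mul (hδ i)
  have h2 := HasDerivAt.fun_sum (u := Finset.univ) fun i (_ : i ∈ Finset.univ) ↦
    HasDerivAt.fun_sum (u := Finset.univ) fun j (_ : j ∈ Finset.univ) ↦ (((hm i j).mul (hδ i)).mul (hδ j))
  have h := h1.add (h2.const_mul (2⁻¹ : ℂ))
  have hfun : (fun s : ℝ ↦ phase P M c (x + s • E4.basisVector 0)) = fun s : ℝ ↦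
      ∑ i, (P (x 0 + s) i.succ : ℂ) * ((x i.succ - c (x 0 + s) i : ℝ) : ℂ) +
      2⁻¹ * ∑ i, ∑ j, M (x 0 + s) i.succ j.succ * ((x i.succ - c (x 0 + s) i : ℝ) : ℂ) *
        ((x j.succ - c (x 0 + s) j : ℝ) : ℂ) := by
    funext s
    simp only [phase, apply_zero_add_smul_basisVector_zero, disp_add_smul_basisVector_zero]
  refine (h.congr_deriv ?_).congr_of_eventuallyEq (Eventually.of_forall fun s ↦ congrFun hfun s)
  simp only [dphase, Fin.cases_zero]
  congr 1
  · refine Finset.sum_congr rfl fun i _ ↦ ?_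
    simp only [disp, add_zero]
    push_cast
    ring
  · congr 1
    refine Finset.sum_congr rfl fun i _ ↦ Finset.sum_congr rfl fun j _ ↦ ?_
    simp only [disp, Pi.mul_apply, add_zero]
    push_cast
    ring


/-! ### The first derivatives along coordinate lines (second derivatives of the phase) -/

/-- The affine factor `s ↦ dᵢ + δ_{ik} s` has derivative `δ_{ik}`. [folklore] -/
theorem hasDerivAt_affine (d : ℂ) (i k : Fin 3) :
    HasDerivAt (fun s : ℝ ↦ d + ((if i = k then s else 0 : ℝ) : ℂ)) (if i = k then 1 else 0) 0 := by
  by_cases hik : i = k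
  · subst hik
    simp only [if_true]
    have h1 : HasDerivAt (fun s : ℝ ↦ ((s : ℝ) : ℂ)) 1 0 := by
      simpa using HasDerivAt.ofReal_comp (hasDerivAt_id (0 : ℝ))
    exact h1.const_add d
  · simp only [hik, if_false, Complex.ofReal_zero, add_zero]
    exact hasDerivAt_const _ _

/-- **`∂_{k+1}∂_{l+1}φ`**: `d/ds|₀ (∂_{l+1}φ)(x + s ∂_{k+1}) = ddphase (k+1) (l+1) x`. [cite: Sbierski2015, §3 (3.9)] -/
theorem hasDerivAt_dphase_succ_spaceLine (P : ℝ → Fin 4 → ℝ) (M : ℝ → Fin 4 → Fin 4 → ℂ)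
    (c : ℝ → E3) (x : E4) (k l : Fin 3) :
    HasDerivAt (fun s : ℝ ↦ dphase P M c l.succ (x + s • E4.basisVector k.succ))
      (ddphase P M c k.succ l.succ x) 0 := by
  have h := HasDerivAt.fun_sum (u := Finset.univ) fun j (_ : j ∈ Finset.univ) ↦
    (hasDerivAt_affine (disp c x j : ℂ) j k).const_mul (M (x 0) l.succ j.succ + M (x 0) j.succ l.succ)
  have h' := (h.const_mul (2⁻¹ : ℂ)).const_add (P (x 0) l.succ : ℂ)
  have hfun : (fun s : ℝ ↦ dphase P M c l.succ (x + s • E4.basisVector k.succ)) = fun s : ℝ ↦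
      (P (x 0) l.succ : ℂ) + 2⁻¹ * ∑ j, (M (x 0) l.succ j.succ + M (x 0) j.succ l.succ) *
        ((disp c x j : ℂ) + ((if j = k then s else 0 : ℝ) : ℂ)) := by
    funext s
    simp only [dphase, Fin.cases_succ, apply_zero_add_smul_basisVector_succ,
      disp_add_smul_basisVector_succ, Complex.ofReal_add]
  refine (h'.congr_deriv ?_).congr_of_eventuallyEq (Eventually.of_forall fun s ↦ congrFun hfun s)
  simp only [ddphase, Fin.cases_succ, mul_ite, mul_one, mul_zero, Finset.sum_ite_eq', Finset.mem_univ,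
    if_true]
  ring

/-- **`∂_{k+1}∂₀φ`**: `d/ds|₀ (∂₀φ)(x + s ∂_{k+1}) = ddphase (k+1) 0 x`. [cite: Sbierski2015, §3 (3.9)] -/
theorem hasDerivAt_dphase_zero_spaceLine (P : ℝ → Fin 4 → ℝ) (M : ℝ → Fin 4 → Fin 4 → ℂ)
    (c : ℝ → E3) (x : E4) (k : Fin 3) :
    HasDerivAt (fun s : ℝ ↦ dphase P M c 0 (x + s • E4.basisVector k.succ))
      (ddphase P M c k.succ 0 x) 0 := by
  have ha := fun j ↦ hasDerivAt_affine (disp c x j : ℂ) j k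
  have ha0 : ∀ j, ((disp c x j : ℂ) + ((if j = k then (0 : ℝ) else 0 : ℝ) : ℂ)) = disp c x j :=
    fun j ↦ by simp
  -- the linear part `∑ᵢ (Ṗᵢ (dᵢ + δ s) − Pᵢ ċᵢ)`
  have h1 := HasDerivAt.fun_sum (u := Finset.univ) fun i (_ : i ∈ Finset.univ) ↦
    ((ha i).const_mul (pdot P (x 0) i.succ : ℂ)).sub_const ((P (x 0) i.succ : ℂ) * (cdot c (x 0) i : ℂ))
  -- the quadratic part
  have h2 := HasDerivAt.fun_sum (u := Finset.univ) fun i (_ : i ∈ Finset.univ) ↦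
    HasDerivAt.fun_sum (u := Finset.univ) fun j (_ : j ∈ Finset.univ) ↦
      ((((ha i).const_mul (mdot M (x 0) i.succ j.succ)).mul (ha j)).sub
        ((((ha j).const_mul (cdot c (x 0) i : ℂ)).add ((ha i).mul_const (cdot c (x 0) j : ℂ))).const_mul
          (M (x 0) i.succ j.succ)))
  have h := h1.add (h2.const_mul (2⁻¹ : ℂ))
  simp only [ha0] at h
  have hfun : (fun s : ℝ ↦ dphase P M c 0 (x + s • E4.basisVector k.succ)) = fun s : ℝ ↦
      ∑ i, ((pdot P (x 0) i.succ : ℂ) * ((disp c x i : ℂ) + ((if i = k then s else 0 : ℝ) : ℂ)) -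
        (P (x 0) i.succ : ℂ) * (cdot c (x 0) i : ℂ)) +
      2⁻¹ * ∑ i, ∑ j, (mdot M (x 0) i.succ j.succ * ((disp c x i : ℂ) + ((if i = k then s else 0 : ℝ) : ℂ)) *
        ((disp c x j : ℂ) + ((if j = k then s else 0 : ℝ) : ℂ)) -
        M (x 0) i.succ j.succ * ((cdot c (x 0) i : ℂ) * ((disp c x j : ℂ) + ((if j = k then s else 0 : ℝ) : ℂ)) +
          ((disp c x i : ℂ) + ((if i = k then s else 0 : ℝ) : ℂ)) * (cdot c (x 0) j : ℂ))) := by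
    funext s
    simp only [dphase, Fin.cases_zero, apply_zero_add_smul_basisVector_succ,
      disp_add_smul_basisVector_succ, Complex.ofReal_add]
  refine (h.congr_deriv ?_).congr_of_eventuallyEq (Eventually.of_forall fun s ↦ congrFun hfun s)
  -- collect the Kronecker deltas
  simp only [ddphase, Fin.cases_succ, Fin.cases_zero, mul_ite, mul_one, mul_zero, ite_mul, zero_mul,
    one_mul, Finset.sum_ite_eq', Finset.mem_univ, if_true, Finset.sum_add_distrib,
    Finset.sum_sub_distrib, mul_add, mul_sub, add_mul, Finset.mul_sum]
  have e1 : ∀ f : Fin 3 → Fin 3 → ℂ, (∑ i, ∑ j, if i = k then f i j else 0) = ∑ j, f k j := by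
    intro f
    rw [Finset.sum_eq_single k (fun i _ hi ↦ by simp [hi]) (by simp)]
    simp
  simp only [e1]
  ring


/-- **`∂₀∂_{l+1}φ`**: `d/ds|₀ (∂_{l+1}φ)(x + s ∂₀) = ddphase 0 (l+1) x`, for data differentiable at
`x⁰`. [cite: Sbierski2015, §3 (3.9)] -/
theorem hasDerivAt_dphase_succ_timeLine (P : ℝ → Fin 4 → ℝ) (M : ℝ → Fin 4 → Fin 4 → ℂ)
    (c : ℝ → E3) (x : E4) (l : Fin 3) (hP : ∀ μ, DifferentiableAt ℝ (fun t ↦ P t μ) (x 0))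
    (hM : ∀ μ ν, DifferentiableAt ℝ (fun t ↦ M t μ ν) (x 0))
    (hc : ∀ i, DifferentiableAt ℝ (fun t ↦ c t i) (x 0)) :
    HasDerivAt (fun s : ℝ ↦ dphase P M c l.succ (x + s • E4.basisVector 0))
      (ddphase P M c 0 l.succ x) 0 := by
  have hp : HasDerivAt (fun s : ℝ ↦ (P (x 0 + s) l.succ : ℂ)) (pdot P (x 0) l.succ : ℂ) 0 :=
    HasDerivAt.ofReal_comp (hasDerivAt_shift (hP l.succ).hasDerivAt)
  have hm : ∀ i j : Fin 3, HasDerivAt (fun s : ℝ ↦ M (x 0 + s) i.succ j.succ)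
      (mdot M (x 0) i.succ j.succ) 0 := fun i j ↦
    hasDerivAt_shift (hM i.succ j.succ).hasDerivAt
  have hδ : ∀ i : Fin 3, HasDerivAt (fun s : ℝ ↦ ((x i.succ - c (x 0 + s) i : ℝ) : ℂ))
      (((-cdot c (x 0) i : ℝ)) : ℂ) 0 := fun i ↦
    HasDerivAt.ofReal_comp ((hasDerivAt_shift (hc i).hasDerivAt).const_sub (x i.succ))
  have h2 := HasDerivAt.fun_sum (u := Finset.univ) fun j (_ : j ∈ Finset.univ) ↦
    ((hm l j).add (hm j l)).mul (hδ j)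
  have h := hp.add (h2.const_mul (2⁻¹ : ℂ))
  have hfun : (fun s : ℝ ↦ dphase P M c l.succ (x + s • E4.basisVector 0)) = fun s : ℝ ↦
      (P (x 0 + s) l.succ : ℂ) + 2⁻¹ * ∑ j, (M (x 0 + s) l.succ j.succ + M (x 0 + s) j.succ l.succ) *
        ((x j.succ - c (x 0 + s) j : ℝ) : ℂ) := by
    funext s
    simp only [dphase, Fin.cases_succ, apply_zero_add_smul_basisVector_zero,
      disp_add_smul_basisVector_zero]
  refine (h.congr_deriv ?_).congr_of_eventuallyEq (Eventually.of_forall fun s ↦ congrFun hfun s)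
  simp only [ddphase, Fin.cases_zero, Fin.cases_succ, add_sub_assoc]
  congr 1
  rw [← mul_sub, ← Finset.sum_sub_distrib]
  congr 1
  refine Finset.sum_congr rfl fun j _ ↦ ?_
  simp only [disp, Pi.add_apply, add_zero]
  push_cast
  ring

/-- **`∂₀∂₀φ`**: `d/ds|₀ (∂₀φ)(x + s ∂₀) = ddphase 0 0 x`, for data twice differentiable at `x⁰`
(the data, their first derivatives and the centre's velocity differentiable at `x⁰`).
[cite: Sbierski2015, §3 (3.9)] -/
theorem hasDerivAt_dphase_zero_timeLine (P : ℝ → Fin 4 → ℝ) (M : ℝ → Fin 4 → Fin 4 → ℂ)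
    (c : ℝ → E3) (x : E4) (hP : ∀ μ, DifferentiableAt ℝ (fun t ↦ P t μ) (x 0))
    (hP' : ∀ μ, DifferentiableAt ℝ (fun t ↦ pdot P t μ) (x 0))
    (hM : ∀ μ ν, DifferentiableAt ℝ (fun t ↦ M t μ ν) (x 0))
    (hM' : ∀ μ ν, DifferentiableAt ℝ (fun t ↦ mdot M t μ ν) (x 0))
    (hc : ∀ i, DifferentiableAt ℝ (fun t ↦ c t i) (x 0))
    (hc' : ∀ i, DifferentiableAt ℝ (fun t ↦ cdot c t i) (x 0)) :
    HasDerivAt (fun s : ℝ ↦ dphase P M c 0 (x + s • E4.basisVector 0)) (ddphase P M c 0 0 x) 0 := by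
  have hp : ∀ i : Fin 3, HasDerivAt (fun s : ℝ ↦ (P (x 0 + s) i.succ : ℂ))
      (pdot P (x 0) i.succ : ℂ) 0 := fun i ↦
    HasDerivAt.ofReal_comp (hasDerivAt_shift (hP i.succ).hasDerivAt)
  have hp' : ∀ i : Fin 3, HasDerivAt (fun s : ℝ ↦ (pdot P (x 0 + s) i.succ : ℂ))
      (pddot P (x 0) i.succ : ℂ) 0 := fun i ↦
    HasDerivAt.ofReal_comp (hasDerivAt_shift (hP' i.succ).hasDerivAt)
  have hm : ∀ i j : Fin 3, HasDerivAt (fun s : ℝ ↦ M (x 0 + s) i.succ j.succ)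
      (mdot M (x 0) i.succ j.succ) 0 := fun i j ↦
    hasDerivAt_shift (hM i.succ j.succ).hasDerivAt
  have hm' : ∀ i j : Fin 3, HasDerivAt (fun s : ℝ ↦ mdot M (x 0 + s) i.succ j.succ)
      (mddot M (x 0) i.succ j.succ) 0 := fun i j ↦
    hasDerivAt_shift (hM' i.succ j.succ).hasDerivAt
  have hδ : ∀ i : Fin 3, HasDerivAt (fun s : ℝ ↦ ((x i.succ - c (x 0 + s) i : ℝ) : ℂ))
      (((-cdot c (x 0) i : ℝ)) : ℂ) 0 := fun i ↦
    HasDerivAt.ofReal_comp ((hasDerivAt_shift (hc i).hasDerivAt).const_sub (x i.succ))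
  have hv : ∀ i : Fin 3, HasDerivAt (fun s : ℝ ↦ (cdot c (x 0 + s) i : ℂ))
      (cddot c (x 0) i : ℂ) 0 := fun i ↦
    HasDerivAt.ofReal_comp (hasDerivAt_shift (hc' i).hasDerivAt)
  -- linear part
  have h1 := HasDerivAt.fun_sum (u := Finset.univ) fun i (_ : i ∈ Finset.univ) ↦
    ((hp' i).mul (hδ i)).sub ((hp i).mul (hv i))
  -- quadratic part
  have h2 := HasDerivAt.fun_sum (u := Finset.univ) fun i (_ : i ∈ Finset.univ) ↦
    HasDerivAt.fun_sum (u := Finset.univ) fun j (_ : j ∈ Finset.univ) ↦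
      ((((hm' i j).mul (hδ i)).mul (hδ j)).sub
        ((hm i j).mul (((hv i).mul (hδ j)).add ((hδ i).mul (hv j)))))
  have h := h1.add (h2.const_mul (2⁻¹ : ℂ))
  have hfun : (fun s : ℝ ↦ dphase P M c 0 (x + s • E4.basisVector 0)) = fun s : ℝ ↦
      ∑ i, ((pdot P (x 0 + s) i.succ : ℂ) * ((x i.succ - c (x 0 + s) i : ℝ) : ℂ) -
        (P (x 0 + s) i.succ : ℂ) * (cdot c (x 0 + s) i : ℂ)) +
      2⁻¹ * ∑ i, ∑ j, (mdot M (x 0 + s) i.succ j.succ * ((x i.succ - c (x 0 + s) i : ℝ) : ℂ) *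
        ((x j.succ - c (x 0 + s) j : ℝ) : ℂ) -
        M (x 0 + s) i.succ j.succ * ((cdot c (x 0 + s) i : ℂ) * ((x j.succ - c (x 0 + s) j : ℝ) : ℂ) +
          ((x i.succ - c (x 0 + s) i : ℝ) : ℂ) * (cdot c (x 0 + s) j : ℂ))) := by
    funext s
    simp only [dphase, Fin.cases_zero, apply_zero_add_smul_basisVector_zero,
      disp_add_smul_basisVector_zero]
  refine (h.congr_deriv ?_).congr_of_eventuallyEq (Eventually.of_forall fun s ↦ congrFun hfun s)
  simp only [ddphase, Fin.cases_zero]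
  congr 1
  · refine Finset.sum_congr rfl fun i _ ↦ ?_
    simp only [disp, add_zero]
    push_cast
    ring
  · congr 1
    refine Finset.sum_congr rfl fun i _ ↦ Finset.sum_congr rfl fun j _ ↦ ?_
    simp only [disp, Pi.add_apply, Pi.mul_apply, add_zero]
    push_cast
    ring


/-! ### Smoothness on the slab over the parameter interval, and the Fréchet partial derivatives -/

section Smooth

variable {P : ℝ → Fin 4 → ℝ} {M : ℝ → Fin 4 → Fin 4 → ℂ} {c : ℝ → E3} {J : Set ℝ}

/-- Derivatives of `C^∞` functions on an open set are `C^∞` there. [folklore] -/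
theorem contDiffOn_deriv_of_isOpen {f : ℝ → ℝ} (hJ : IsOpen J) (hf : ContDiffOn ℝ ∞ f J) :
    ContDiffOn ℝ ∞ (deriv f) J :=
  ((contDiffOn_infty_iff_deriv_of_isOpen hJ).1 hf).2

/-- Derivatives of `C^∞` complex-valued functions on an open set are `C^∞` there. [folklore] -/
theorem contDiffOn_deriv_of_isOpen' {f : ℝ → ℂ} (hJ : IsOpen J) (hf : ContDiffOn ℝ ∞ f J) :
    ContDiffOn ℝ ∞ (deriv f) J :=
  ((contDiffOn_infty_iff_deriv_of_isOpen hJ).1 hf).2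

/-- A `C^∞` function of the parameter, read through the time coordinate, is `C^∞` on the slab
`{x | x⁰ ∈ J}`. [folklore] -/
theorem contDiffOn_comp_time {F : Type*} [NormedAddCommGroup F] [NormedSpace ℝ F] {f : ℝ → F}
    (hf : ContDiffOn ℝ ∞ f J) : ContDiffOn ℝ ∞ (fun x : E4 ↦ f (x 0)) {x : E4 | x 0 ∈ J} :=
  hf.comp (E4.dx 0).contDiff.contDiffOn fun _ hx ↦ hx

/-- The displacement is `C^∞` on the slab when the centre is `C^∞` on `J`. [folklore] -/
theorem contDiffOn_disp (hc : ∀ i, ContDiffOn ℝ ∞ (fun t ↦ c t i) J) (i : Fin 3) :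
    ContDiffOn ℝ ∞ (fun x : E4 ↦ disp c x i) {x : E4 | x 0 ∈ J} :=
  ((E4.dx i.succ).contDiff.contDiffOn).sub (contDiffOn_comp_time (hc i))

/-- **The phase is `C^∞` on the slab `{x⁰ ∈ J}`** when `P`, `M`, `c` are `C^∞` on `J`. [cite: Sbierski2015, §3 Def. 3.13] -/
theorem contDiffOn_phase (hP : ∀ μ, ContDiffOn ℝ ∞ (fun t ↦ P t μ) J)
    (hM : ∀ μ ν, ContDiffOn ℝ ∞ (fun t ↦ M t μ ν) J) (hc : ∀ i, ContDiffOn ℝ ∞ (fun t ↦ c t i) J) :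
    ContDiffOn ℝ ∞ (phase P M c) {x : E4 | x 0 ∈ J} := by
  have hdisp : ∀ i, ContDiffOn ℝ ∞ (fun x : E4 ↦ (disp c x i : ℂ)) {x : E4 | x 0 ∈ J} := fun i ↦
    Complex.ofRealCLM.contDiff.comp_contDiffOn (contDiffOn_disp hc i)
  have hPc : ∀ μ, ContDiffOn ℝ ∞ (fun x : E4 ↦ (P (x 0) μ : ℂ)) {x : E4 | x 0 ∈ J} := fun μ ↦
    Complex.ofRealCLM.contDiff.comp_contDiffOn (contDiffOn_comp_time (hP μ))
  have hMc : ∀ μ ν, ContDiffOn ℝ ∞ (fun x : E4 ↦ M (x 0) μ ν) {x : E4 | x 0 ∈ J} := fun μ ν ↦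
    contDiffOn_comp_time (hM μ ν)
  unfold phase
  refine (ContDiffOn.sum fun i _ ↦ (hPc _).mul (hdisp i)).add (contDiffOn_const.mul ?_)
  exact ContDiffOn.sum fun i _ ↦ ContDiffOn.sum fun j _ ↦ ((hMc _ _).mul (hdisp i)).mul (hdisp j)

/-- **The components `∂_μφ` are `C^∞` on the slab** when `P`, `M`, `c` are `C^∞` on the open set
`J`. [cite: Sbierski2015, §3 Def. 3.13] -/
theorem contDiffOn_dphase (hJ : IsOpen J) (hP : ∀ μ, ContDiffOn ℝ ∞ (fun t ↦ P t μ) J)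
    (hM : ∀ μ ν, ContDiffOn ℝ ∞ (fun t ↦ M t μ ν) J) (hc : ∀ i, ContDiffOn ℝ ∞ (fun t ↦ c t i) J)
    (μ : Fin 4) : ContDiffOn ℝ ∞ (dphase P M c μ) {x : E4 | x 0 ∈ J} := by
  have hdisp : ∀ i, ContDiffOn ℝ ∞ (fun x : E4 ↦ (disp c x i : ℂ)) {x : E4 | x 0 ∈ J} := fun i ↦
    Complex.ofRealCLM.contDiff.comp_contDiffOn (contDiffOn_disp hc i)
  have hPc : ∀ μ, ContDiffOn ℝ ∞ (fun x : E4 ↦ (P (x 0) μ : ℂ)) {x : E4 | x 0 ∈ J} := fun μ ↦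
    Complex.ofRealCLM.contDiff.comp_contDiffOn (contDiffOn_comp_time (hP μ))
  have hP'c : ∀ μ, ContDiffOn ℝ ∞ (fun x : E4 ↦ (pdot P (x 0) μ : ℂ)) {x : E4 | x 0 ∈ J} := fun μ ↦
    Complex.ofRealCLM.contDiff.comp_contDiffOn
      (contDiffOn_comp_time (f := fun t ↦ pdot P t μ) (contDiffOn_deriv_of_isOpen hJ (hP μ)))
  have hMc : ∀ μ ν, ContDiffOn ℝ ∞ (fun x : E4 ↦ M (x 0) μ ν) {x : E4 | x 0 ∈ J} := fun μ ν ↦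
    contDiffOn_comp_time (hM μ ν)
  have hM'c : ∀ μ ν, ContDiffOn ℝ ∞ (fun x : E4 ↦ mdot M (x 0) μ ν) {x : E4 | x 0 ∈ J} := fun μ ν ↦
    contDiffOn_comp_time (f := fun t ↦ mdot M t μ ν) (contDiffOn_deriv_of_isOpen' hJ (hM μ ν))
  have hcd : ∀ i, ContDiffOn ℝ ∞ (fun x : E4 ↦ (cdot c (x 0) i : ℂ)) {x : E4 | x 0 ∈ J} := fun i ↦
    Complex.ofRealCLM.contDiff.comp_contDiffOn
      (contDiffOn_comp_time (f := fun t ↦ cdot c t i) (contDiffOn_deriv_of_isOpen hJ (hc i)))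
  refine Fin.cases ?_ (fun k ↦ ?_) μ
  · refine (ContDiffOn.sum fun i _ ↦ ((hP'c _).mul (hdisp i)).sub ((hPc _).mul (hcd i))).add
      (contDiffOn_const.mul ?_)
    exact ContDiffOn.sum fun i _ ↦ ContDiffOn.sum fun j _ ↦
      (((hM'c _ _).mul (hdisp i)).mul (hdisp j)).sub
        ((hMc _ _).mul (((hcd i).mul (hdisp j)).add ((hdisp i).mul (hcd j))))
  · exact (hPc _).add (contDiffOn_const.mul
      (ContDiffOn.sum fun j _ ↦ ((hMc _ _).add (hMc _ _)).mul (hdisp j)))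

/-- The slab over an open parameter set is open. [folklore] -/
theorem isOpen_slab (hJ : IsOpen J) : IsOpen {x : E4 | x 0 ∈ J} :=
  hJ.preimage (E4.dx 0).continuous

/-- **The Fréchet partial derivatives of the phase are the explicit components**:
`Dφ(x)(∂_μ) = dphase μ x` for `x⁰ ∈ J`. [cite: Sbierski2015, §3 (3.12)] -/
theorem fderiv_phase (hJ : IsOpen J) (hP : ∀ μ, ContDiffOn ℝ ∞ (fun t ↦ P t μ) J)
    (hM : ∀ μ ν, ContDiffOn ℝ ∞ (fun t ↦ M t μ ν) J) (hc : ∀ i, ContDiffOn ℝ ∞ (fun t ↦ c t i) J)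
    {x : E4} (hx : x 0 ∈ J) (μ : Fin 4) :
    fderiv ℝ (phase P M c) x (E4.basisVector μ) = dphase P M c μ x := by
  have hslab : {x : E4 | x 0 ∈ J} ∈ 𝓝 x := (isOpen_slab hJ).mem_nhds hx
  have hdiff : DifferentiableAt ℝ (phase P M c) x :=
    ((contDiffOn_phase hP hM hc).contDiffAt hslab).differentiableAt (by simp)
  -- the derivative along the coordinate line, computed two ways
  have hline : HasDerivAt (fun s : ℝ ↦ x + s • E4.basisVector μ) (E4.basisVector μ) 0 := by
    simpa using ((hasDerivAt_id (0 : ℝ)).smul_const (E4.basisVector μ)).const_add x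
  have h1 : HasDerivAt (fun s : ℝ ↦ phase P M c (x + s • E4.basisVector μ))
      (fderiv ℝ (phase P M c) x (E4.basisVector μ)) 0 := by
    exact hdiff.hasFDerivAt.comp_hasDerivAt_of_eq (0 : ℝ) hline (by simp)
  have hJx : J ∈ 𝓝 (x 0) := hJ.mem_nhds hx
  have h2 : HasDerivAt (fun s : ℝ ↦ phase P M c (x + s • E4.basisVector μ)) (dphase P M c μ x) 0 := by
    refine Fin.cases ?_ (fun k ↦ ?_) μ
    · exact hasDerivAt_phase_timeLine P M c x
        (fun μ ↦ ((hP μ).contDiffAt hJx).differentiableAt (by simp))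
        (fun μ ν ↦ ((hM μ ν).contDiffAt hJx).differentiableAt (by simp))
        (fun i ↦ ((hc i).contDiffAt hJx).differentiableAt (by simp))
    · exact hasDerivAt_phase_spaceLine P M c x k
  exact h1.unique h2

/-- **The Fréchet partial derivatives of `∂_νφ` are the explicit components**:
`D(∂_νφ)(x)(∂_μ) = ddphase μ ν x` for `x⁰ ∈ J`. [cite: Sbierski2015, §3 (3.9)] -/
theorem fderiv_dphase (hJ : IsOpen J) (hP : ∀ μ, ContDiffOn ℝ ∞ (fun t ↦ P t μ) J)
    (hM : ∀ μ ν, ContDiffOn ℝ ∞ (fun t ↦ M t μ ν) J) (hc : ∀ i, ContDiffOn ℝ ∞ (fun t ↦ c t i) J)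
    {x : E4} (hx : x 0 ∈ J) (μ ν : Fin 4) :
    fderiv ℝ (dphase P M c ν) x (E4.basisVector μ) = ddphase P M c μ ν x := by
  have hslab : {x : E4 | x 0 ∈ J} ∈ 𝓝 x := (isOpen_slab hJ).mem_nhds hx
  have hdiff : DifferentiableAt ℝ (dphase P M c ν) x :=
    ((contDiffOn_dphase hJ hP hM hc ν).contDiffAt hslab).differentiableAt (by simp)
  have hline : HasDerivAt (fun s : ℝ ↦ x + s • E4.basisVector μ) (E4.basisVector μ) 0 := by
    simpa using ((hasDerivAt_id (0 : ℝ)).smul_const (E4.basisVector μ)).const_add x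
  have h1 : HasDerivAt (fun s : ℝ ↦ dphase P M c ν (x + s • E4.basisVector μ))
      (fderiv ℝ (dphase P M c ν) x (E4.basisVector μ)) 0 := by
    exact hdiff.hasFDerivAt.comp_hasDerivAt_of_eq (0 : ℝ) hline (by simp)
  have hJx : J ∈ 𝓝 (x 0) := hJ.mem_nhds hx
  have dP : ∀ μ, DifferentiableAt ℝ (fun t ↦ P t μ) (x 0) := fun μ ↦
    ((hP μ).contDiffAt hJx).differentiableAt (by simp)
  have dP' : ∀ μ, DifferentiableAt ℝ (fun t ↦ pdot P t μ) (x 0) := fun μ ↦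
    ((contDiffOn_deriv_of_isOpen hJ (hP μ)).contDiffAt hJx).differentiableAt (by simp)
  have dM : ∀ μ ν, DifferentiableAt ℝ (fun t ↦ M t μ ν) (x 0) := fun μ ν ↦
    ((hM μ ν).contDiffAt hJx).differentiableAt (by simp)
  have dM' : ∀ μ ν, DifferentiableAt ℝ (fun t ↦ mdot M t μ ν) (x 0) := fun μ ν ↦
    ((contDiffOn_deriv_of_isOpen' hJ (hM μ ν)).contDiffAt hJx).differentiableAt (by simp)
  have dc : ∀ i, DifferentiableAt ℝ (fun t ↦ c t i) (x 0) := fun i ↦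
    ((hc i).contDiffAt hJx).differentiableAt (by simp)
  have dc' : ∀ i, DifferentiableAt ℝ (fun t ↦ cdot c t i) (x 0) := fun i ↦
    ((contDiffOn_deriv_of_isOpen hJ (hc i)).contDiffAt hJx).differentiableAt (by simp)
  have h2 : HasDerivAt (fun s : ℝ ↦ dphase P M c ν (x + s • E4.basisVector μ))
      (ddphase P M c μ ν x) 0 := by
    refine Fin.cases ?_ (fun k ↦ ?_) μ
    · refine Fin.cases ?_ (fun l ↦ ?_) ν
      · exact hasDerivAt_dphase_zero_timeLine P M c x dP dP' dM dM' dc dc'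
      · exact hasDerivAt_dphase_succ_timeLine P M c x l dP dM dc
    · refine Fin.cases ?_ (fun l ↦ ?_) ν
      · exact hasDerivAt_dphase_zero_spaceLine P M c x k
      · exact hasDerivAt_dphase_succ_spaceLine P M c x k l
  exact h1.unique h2

end Smooth


/-! ### The jets of the phase along the curve `X(t) = (t, c(t))` -/

section Curve

variable (P : ℝ → Fin 4 → ℝ) (M : ℝ → Fin 4 → Fin 4 → ℂ) (c : ℝ → E3)

/-- The displacement vanishes on the curve. [folklore] -/
@[simp]
theorem disp_curve (t : ℝ) (i : Fin 3) : disp c (E4.ofTimeSpace t (c t)) i = 0 := by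
  simp [disp]

/-- The phase vanishes on the curve (`φ|_γ` real: here `0`; Sbierski's (3.2)). [cite: Sbierski2015, §3 (3.2)] -/
theorem phase_curve (t : ℝ) : phase P M c (E4.ofTimeSpace t (c t)) = 0 := by
  simp [phase]

/-- **`dφ|_X = P`, spatial components** (Sbierski's (3.12): `dφ := γ̇♭` along `γ`).
[cite: Sbierski2015, §3 (3.12)] -/
theorem dphase_succ_curve (t : ℝ) (k : Fin 3) : dphase P M c k.succ (E4.ofTimeSpace t (c t)) = P t k.succ := by
  simp [dphase]

/-- **`dφ|_X = P`, time component**, provided `P · Ẋ = 0` for `Ẋ = (1, ċ)` (for a null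
bicharacteristic `P(Ẋ) = g⁻¹(P, P)/κ = 0`). [cite: Sbierski2015, §3 (3.12)] -/
theorem dphase_zero_curve (t : ℝ) (hPX : P t 0 + ∑ i : Fin 3, P t i.succ * cdot c t i = 0) :
    dphase P M c 0 (E4.ofTimeSpace t (c t)) = P t 0 := by
  have h : (P t 0 : ℂ) = -∑ i : Fin 3, (P t i.succ : ℂ) * (cdot c t i : ℂ) := by
    have := congrArg ((↑) : ℝ → ℂ) hPX
    push_cast at this
    linear_combination this
  rw [h]
  simp [dphase, Finset.sum_neg_distrib]

/-- **`dφ|_X = P`** (all components), under `P · Ẋ = 0`. [cite: Sbierski2015, §3 (3.12)] -/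
theorem dphase_curve (t : ℝ) (hPX : P t 0 + ∑ i : Fin 3, P t i.succ * cdot c t i = 0) (μ : Fin 4) :
    dphase P M c μ (E4.ofTimeSpace t (c t)) = P t μ :=
  Fin.cases (dphase_zero_curve P M c t hPX) (fun k ↦ dphase_succ_curve P M c t k) μ

/-- **`∂∂φ|_X = M`** (all components), for `M(t)` symmetric and *compatible with the first
derivatives*, `M Ẋ = Ṗ` (Sbierski, arXiv:1311.2477v2 (2.21): `∂_μ∂_νφ(γ(s)) γ̇^ν(s) =
d/ds ∂_μφ(γ(s))`; here `Ẋ = (1, ċ)`), and given the differentiated constraint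
`d/dt (P · Ẋ) = Ṗ₀ + ∑ⱼ (Ṗ_{j+1} ċⱼ + P_{j+1} c̈ⱼ) = 0`: the spatial block is `M` by construction,
the time–space entries are forced to `M_{0,l+1} = Ṗ_{l+1} − ∑ⱼ M_{l+1,j+1} ċⱼ` and the time–time
entry to `M₀₀ = Ṗ₀ − ∑ⱼ M_{0,j+1} ċⱼ` by the compatibility. [cite: Sbierski2015, §3; arXiv v2 §2.2 (2.21)] -/
theorem ddphase_curve (t : ℝ) (hsymm : ∀ μ ν, M t μ ν = M t ν μ)
    (hMX : ∀ μ, M t μ 0 + ∑ j : Fin 3, M t μ j.succ * (cdot c t j : ℂ) = (pdot P t μ : ℂ))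
    (hPX' : pdot P t 0 + ∑ j : Fin 3, (pdot P t j.succ * cdot c t j + P t j.succ * cddot c t j) = 0)
    (μ ν : Fin 4) : ddphase P M c μ ν (E4.ofTimeSpace t (c t)) = M t μ ν := by
  -- the time–space entries from the compatibility
  have hrow : ∀ l : Fin 3, M t l.succ 0 =
      (pdot P t l.succ : ℂ) - ∑ j : Fin 3, M t l.succ j.succ * (cdot c t j : ℂ) := fun l ↦ by
    linear_combination hMX l.succ
  have hsum : ∀ l : Fin 3, ∑ j : Fin 3, (M t l.succ j.succ + M t j.succ l.succ) * (cdot c t j : ℂ) =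
      2 * ∑ j : Fin 3, M t l.succ j.succ * (cdot c t j : ℂ) := fun l ↦ by
    rw [Finset.mul_sum]
    refine Finset.sum_congr rfl fun j _ ↦ ?_
    rw [hsymm j.succ l.succ]
    ring
  have hts : ∀ l : Fin 3, (pdot P t l.succ : ℂ) +
      2⁻¹ * ∑ j : Fin 3, (mdot M t l.succ j.succ + mdot M t j.succ l.succ) * ((0 : ℝ) : ℂ) -
      2⁻¹ * ∑ j : Fin 3, (M t l.succ j.succ + M t j.succ l.succ) * (cdot c t j : ℂ) = M t l.succ 0 := by
    intro l
    rw [hsum l, hrow l]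
    simp
  refine Fin.cases ?_ (fun k ↦ ?_) μ
  · refine Fin.cases ?_ (fun l ↦ ?_) ν
    · -- time–time
      have hj : ∀ j : Fin 3, M t 0 j.succ =
          (pdot P t j.succ : ℂ) - ∑ i : Fin 3, M t j.succ i.succ * (cdot c t i : ℂ) := fun j ↦ by
        rw [hsymm 0 j.succ]; exact hrow j
      have h0 : M t 0 0 = (pdot P t 0 : ℂ) - ∑ j : Fin 3, M t 0 j.succ * (cdot c t j : ℂ) := by
        linear_combination hMX 0
      have hP0 : (pdot P t 0 : ℂ) =
          -∑ j : Fin 3, ((pdot P t j.succ : ℂ) * (cdot c t j : ℂ) + (P t j.succ : ℂ) * (cddot c t j : ℂ)) := by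
        have := congrArg ((↑) : ℝ → ℂ) hPX'
        push_cast at this
        linear_combination this
      rw [h0, Finset.sum_congr rfl fun j _ ↦ by rw [hj j], hP0]
      simp only [ddphase, Fin.cases_zero, E4.ofTimeSpace_apply_zero, disp_curve, Complex.ofReal_zero,
        mul_zero, zero_mul, sub_zero, zero_sub, zero_add, add_zero, Finset.sum_const_zero, sub_mul,
        Finset.sum_sub_distrib, Finset.sum_add_distrib, Finset.sum_neg_distrib, Finset.mul_sum,
        Finset.sum_mul]
      rw [Finset.sum_comm (f := fun j i ↦ M t j.succ i.succ * (cdot c t i : ℂ) * (cdot c t j : ℂ))]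
      have e : ∀ i j : Fin 3, (2 : ℂ)⁻¹ * (2 * M t i.succ j.succ * (cdot c t i : ℂ) * (cdot c t j : ℂ)) =
          M t i.succ j.succ * (cdot c t j : ℂ) * (cdot c t i : ℂ) := fun i j ↦ by ring
      simp only [e]
      rw [show (∑ x : Fin 3, ∑ y : Fin 3, M t y.succ x.succ * (cdot c t x : ℂ) * (cdot c t y : ℂ)) =
          ∑ x : Fin 3, ∑ y : Fin 3, M t x.succ y.succ * (cdot c t y : ℂ) * (cdot c t x : ℂ) from
        Finset.sum_comm,
        show (∑ x : Fin 3, 2 * (pdot P t x.succ : ℂ) * (cdot c t x : ℂ)) =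
          2 * ∑ x : Fin 3, (pdot P t x.succ : ℂ) * (cdot c t x : ℂ) by
          rw [Finset.mul_sum]; exact Finset.sum_congr rfl fun x _ ↦ by ring]
      ring
    · -- time–space
      simp only [ddphase, Fin.cases_zero, Fin.cases_succ, E4.ofTimeSpace_apply_zero, disp_curve]
      rw [hsymm 0 l.succ]
      exact hts l
  · refine Fin.cases ?_ (fun l ↦ ?_) ν
    · -- space–time
      simp only [ddphase, Fin.cases_zero, Fin.cases_succ, E4.ofTimeSpace_apply_zero, disp_curve]
      exact hts k
    · -- space–space
      simp only [ddphase, Fin.cases_succ, E4.ofTimeSpace_apply_zero]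
      rw [hsymm l.succ k.succ]
      ring

end Curve


/-! ### The differentiated constraint `d/dt (P · Ẋ) = 0` -/

/-- If `P · Ẋ = P₀ + ∑ᵢ P_{i+1} ċᵢ` vanishes on the open parameter set `J` (data `C^∞` there), then
so does its derivative `Ṗ₀ + ∑ⱼ (Ṗ_{j+1} ċⱼ + P_{j+1} c̈ⱼ)` — the hypothesis of `ddphase_curve`. [folklore] -/
theorem deriv_constraint_eq_zero {P : ℝ → Fin 4 → ℝ} {c : ℝ → E3} {J : Set ℝ} (hJ : IsOpen J)
    (hP : ∀ μ, ContDiffOn ℝ ∞ (fun t ↦ P t μ) J) (hc : ∀ i, ContDiffOn ℝ ∞ (fun t ↦ c t i) J)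
    (hPX : ∀ t ∈ J, P t 0 + ∑ i : Fin 3, P t i.succ * cdot c t i = 0) {t : ℝ} (ht : t ∈ J) :
    pdot P t 0 + ∑ j : Fin 3, (pdot P t j.succ * cdot c t j + P t j.succ * cddot c t j) = 0 := by
  have hJt : J ∈ 𝓝 t := hJ.mem_nhds ht
  have dP : ∀ μ, HasDerivAt (fun s ↦ P s μ) (pdot P t μ) t := fun μ ↦
    (((hP μ).contDiffAt hJt).differentiableAt (by simp)).hasDerivAt
  have dc' : ∀ i, HasDerivAt (fun s ↦ cdot c s i) (cddot c t i) t := fun i ↦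
    (((contDiffOn_deriv_of_isOpen hJ (hc i)).contDiffAt hJt).differentiableAt (by simp)).hasDerivAt
  have hF : HasDerivAt (fun s ↦ P s 0 + ∑ i : Fin 3, P s i.succ * cdot c s i)
      (pdot P t 0 + ∑ j : Fin 3, (pdot P t j.succ * cdot c t j + P t j.succ * cddot c t j)) t :=
    (dP 0).add (HasDerivAt.fun_sum (u := Finset.univ) fun j (_ : j ∈ Finset.univ) ↦
      (dP j.succ).mul (dc' j))
  have hzero : (fun s ↦ P s 0 + ∑ i : Fin 3, P s i.succ * cdot c s i) =ᶠ[𝓝 t] fun _ ↦ (0 : ℝ) :=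
    Filter.eventually_of_mem hJt fun s hs ↦ hPX s hs
  have h := hF.deriv
  rw [hzero.deriv_eq, deriv_const] at h
  exact h.symm

/-! ### The imaginary part: an exact Gaussian on every leaf -/

section Im

variable (P : ℝ → Fin 4 → ℝ) (M : ℝ → Fin 4 → Fin 4 → ℂ) (c : ℝ → E3)

/-- **`Im φ(x) = ½ ∑_{ij} Im M_{i+1,j+1}(x⁰) dᵢ dⱼ`** — the momenta being real, the imaginary part of
the phase is exactly the quadratic form of `Im M` on the displacement (Sbierski's (3.2)–(3.4):
`φ|_γ`, `dφ|_γ` real and `Im(φ)(x) ≥ c (x₁² + x₂² + x₃²)` in slice coordinates).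
[cite: Sbierski2015, §3 (3.2)–(3.4)] -/
theorem im_phase (x : E4) :
    (phase P M c x).im = 2⁻¹ * ∑ i : Fin 3, ∑ j : Fin 3, (M (x 0) i.succ j.succ).im * disp c x i * disp c x j := by
  have h2 : (2⁻¹ : ℂ) = ((2⁻¹ : ℝ) : ℂ) := by norm_num
  simp only [phase, h2, Complex.add_im, Complex.im_sum, Complex.mul_im, Complex.mul_re,
    Complex.ofReal_re, Complex.ofReal_im, mul_zero, zero_mul, add_zero, sub_zero,
    Finset.sum_const_zero, zero_add, Finset.mul_sum]

/-- Homogeneity of the quadratic form of `Im M` on spatial vectors. [folklore] -/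
theorem imQuad_smul (m : Fin 3 → Fin 3 → ℝ) (r : ℝ) (u : E3) :
    ∑ i : Fin 3, ∑ j : Fin 3, m i j * (r • u) i * (r • u) j =
      r ^ 2 * ∑ i : Fin 3, ∑ j : Fin 3, m i j * u i * u j := by
  simp only [PiLp.smul_apply, smul_eq_mul, Finset.mul_sum]
  refine Finset.sum_congr rfl fun i _ ↦ Finset.sum_congr rfl fun j _ ↦ ?_
  ring

/-- **Uniform Gaussian lower bound for the exponent.** If `Im M(t)` is positive definite on spatial
vectors for `t` in a compact set `K` on which it is continuous, then for some `c₀ > 0`,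
`∑_{ij} Im M_{i+1,j+1}(t) dᵢ dⱼ ≥ c₀ ‖d‖²` for all `t ∈ K` and all `d` (minimum over the compact set
`K × S²` and homogeneity) — with `im_phase`, Sbierski's (3.4) `Im φ ≥ c |x̲|²` uniformly along the
beam. [cite: Sbierski2015, §3 (3.4)] -/
theorem exists_pos_le_imQuad {K : Set ℝ} (hK : IsCompact K)
    (hMc : ∀ i j : Fin 3, ContinuousOn (fun t ↦ (M t i.succ j.succ).im) K)
    (hpos : ∀ t ∈ K, ∀ d : E3, d ≠ 0 → 0 < ∑ i : Fin 3, ∑ j : Fin 3, (M t i.succ j.succ).im * d i * d j) :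
    ∃ c₀ : ℝ, 0 < c₀ ∧ ∀ t ∈ K, ∀ d : E3,
      c₀ * ‖d‖ ^ 2 ≤ ∑ i : Fin 3, ∑ j : Fin 3, (M t i.succ j.succ).im * d i * d j := by
  rcases K.eq_empty_or_nonempty with hKe | hKne
  · exact ⟨1, one_pos, fun t ht ↦ by simp [hKe] at ht⟩
  set q : ℝ × E3 → ℝ := fun p ↦ ∑ i : Fin 3, ∑ j : Fin 3, (M p.1 i.succ j.succ).im * p.2 i * p.2 j
    with hq
  set S : Set (ℝ × E3) := K ×ˢ Metric.sphere (0 : E3) 1 with hS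
  have hSc : IsCompact S := hK.prod (isCompact_sphere 0 1)
  obtain ⟨t₀, ht₀⟩ := hKne
  have hu₀ : (EuclideanSpace.single (0 : Fin 3) (1 : ℝ) : E3) ∈ Metric.sphere (0 : E3) 1 := by
    simp
  have hSne : S.Nonempty := ⟨(t₀, EuclideanSpace.single (0 : Fin 3) (1 : ℝ)), ⟨ht₀, hu₀⟩⟩
  have hqc : ContinuousOn q S := by
    refine continuousOn_finsetSum _ fun i _ ↦ continuousOn_finsetSum _ fun j _ ↦ ?_
    have h1 : ContinuousOn (fun p : ℝ × E3 ↦ (M p.1 i.succ j.succ).im) S :=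
      (hMc i j).comp continuousOn_fst fun p hp ↦ hp.1
    have h2 : ∀ k : Fin 3, Continuous fun p : ℝ × E3 ↦ p.2 k := fun k ↦
      (EuclideanSpace.proj k).continuous.comp continuous_snd
    exact (h1.mul (h2 i).continuousOn).mul (h2 j).continuousOn
  obtain ⟨p₀, hp₀S, hmin⟩ := hSc.exists_isMinOn hSne hqc
  have hp₀ne : p₀.2 ≠ 0 := by
    intro h0
    have h1 : ‖p₀.2‖ = 1 := by simpa [hS] using hp₀S.2
    rw [h0, norm_zero] at h1
    exact zero_ne_one h1
  have hc₀ : 0 < q p₀ := hpos p₀.1 hp₀S.1 p₀.2 hp₀ne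
  refine ⟨q p₀, hc₀, fun t ht d ↦ ?_⟩
  by_cases hd : d = 0
  · subst hd
    simp
  · have hdn : 0 < ‖d‖ := norm_pos_iff.2 hd
    set u : E3 := ‖d‖⁻¹ • d with hu
    have hun : ‖u‖ = 1 := by
      rw [hu, norm_smul, norm_inv, norm_norm, inv_mul_cancel₀ hdn.ne']
    have huS : (t, u) ∈ S := ⟨ht, by simpa using hun⟩
    have hmin' : q p₀ ≤ q (t, u) := hmin huS
    have hdu : d = ‖d‖ • u := by
      rw [hu, smul_smul, mul_inv_cancel₀ hdn.ne', one_smul]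
    have hscale : ∑ i : Fin 3, ∑ j : Fin 3, (M t i.succ j.succ).im * d i * d j =
        ‖d‖ ^ 2 * ∑ i : Fin 3, ∑ j : Fin 3, (M t i.succ j.succ).im * u i * u j := by
      conv_lhs => rw [hdu]
      exact imQuad_smul (fun i j ↦ (M t i.succ j.succ).im) ‖d‖ u
    rw [hscale]
    have : q (t, u) = ∑ i : Fin 3, ∑ j : Fin 3, (M t i.succ j.succ).im * u i * u j := rfl
    rw [← this]
    nlinarith [sq_nonneg ‖d‖]

/-- **`Im φ ≥ c₀ ‖d‖²` uniformly over compact parameter sets** (the exact-Gaussian form of Sbierski's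
(3.4)). [cite: Sbierski2015, §3 (3.4)] -/
theorem exists_pos_le_im_phase {K : Set ℝ} (hK : IsCompact K)
    (hMc : ∀ i j : Fin 3, ContinuousOn (fun t ↦ (M t i.succ j.succ).im) K)
    (hpos : ∀ t ∈ K, ∀ d : E3, d ≠ 0 → 0 < ∑ i : Fin 3, ∑ j : Fin 3, (M t i.succ j.succ).im * d i * d j) :
    ∃ c₀ : ℝ, 0 < c₀ ∧ ∀ x : E4, x 0 ∈ K →
      c₀ * ∑ i : Fin 3, disp c x i ^ 2 ≤ (phase P M c x).im := by
  obtain ⟨c₁, hc₁, h⟩ := exists_pos_le_imQuad M hK hMc hpos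
  refine ⟨2⁻¹ * c₁, by positivity, fun x hx ↦ ?_⟩
  set d : E3 := WithLp.toLp 2 fun i ↦ disp c x i with hd
  have hdi : ∀ i, d i = disp c x i := fun i ↦ rfl
  have hnorm : ‖d‖ ^ 2 = ∑ i : Fin 3, disp c x i ^ 2 := by
    rw [EuclideanSpace.norm_sq_eq]
    simp [hdi]
  have hq := h (x 0) hx d
  rw [im_phase, ← hnorm]
  simp only [hdi] at hq
  nlinarith [hq]

end Im


end GaussianBeam

end Literature.Geometry.Lorentzian

end
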